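import Summits.HubbardSuperconductivity.HubbardLadder.Bounds.GaugeStiffnessCeiling
import Literature.MathematicalPhysics.QuantumLattice.HubbardNNNHoppingFluxGaugeFunctionThermal
import HarnessLib

/-!
# The gauge-function (resistor-network) stiffness ceiling at `T > 0` (pub-hubbard BOUNDS; bounds.tex Thm 4, `T > 0` clause; proved)

HONEST FRAMING: ladder R1–R4 with certified numbers; no claim on H/H₀. Bounds for a MODEL CLASS
(the `t–t'` Hubbard torus `hubbardTorusTT' L 1 t' U` on `(ℤ/L)²`, every `t'`, `U`, every
coordinate sector `p` — fixed `(N↑, N↓)`, fixed `N`, … — and every inverse temperature `β > 0`),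
no materials claim.

This is the positive-temperature companion of `GaugeStiffnessCeiling.lean` (bounds.tex Thm 4 /
Thm 4♯ at `T = 0`): Paramekanti–Trivedi–Randeria 1998 §IV, "Generalization to finite temperatures"
(trial density matrix `U ρ̂₀ U†`, eq. (trial-rho)): the same resistor-network bound with THERMAL
bond kinetic weights. The thermal flux stiffness of the sector `p` is read off the sector free
energy exactly as in the tree's thermal nodes (`ThermalCurrentMomentStiffnessCeilingTT'`,
`ThermalHalfBathtubStiffnessBoundTT'`): `ρ_s` is any real with
`β ρ_s θ² ≤ log Z_{β,p}(0) − log Z_{β,p}(θ)` for `|θ| ≤ θ₀`, `Z_{β,p}(θ)` the partition function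
of the `p`-block of `hubbardTorusTT'Flux L t' U θ`.

* `ThermalGaugeFunctionStiffnessCeilingTT'` (PROVED, `…_holds`): for EVERY `φ : (ℤ/L)² → ℝ`,
  `ρ_s L² ≤ ½ [Σ_{x,i,σ} (δ_{i,0} + φ(x+eᵢ) − φ(x))² Re⟨B_{x,i,σ}⟩_{β,p}
   + t' Σ_{s,x,σ} (1 + φ(x+j_s) − φ(x))² Re⟨B^d_{s,x,σ}⟩_{β,p}]`, `B = c†_{x+eᵢ,σ} c_{x,σ} + h.c.` the
  symmetrised bond operators, `⟨·⟩_{β,p}` the Gibbs state of the untwisted block — exact thermal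
  bond weights of either sign, `ρ_s` of either sign (from the Literature `1 − cos` bound
  `log_partitionFn_toBlock_hubbardTorusTT'Flux_ge_trialGauge` and the `θ → 0` extraction
  `mul_sq_le_sum_of_forall_oneSubCos` of the `T = 0` file).
* `ThermalColumnStiffnessCeilingTT'`, `ThermalSeriesLawStiffnessCeilingTT'`,
  `ThermalBottleneckStiffnessCeilingTT'` (all PROVED): the column form `ρ_s L² ≤ Σ_c g(c)² W_c`
  (`Σ_c g(c) = L`), the series law `ρ_s ≤ (Σ_c W_c⁻¹)⁻¹` for positive thermal column weights
  `W_c = thermalColumnWeightTT'` (PTR98 eqs. (1d-bd), (leg-bd) `D_s ≤ D°_s` at `T > 0`), and the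
  bottleneck bound `ρ_s ≤ W_c` for every column `c`.
For a translation-invariant Gibbs state all `W_c` coincide and the column bounds reduce to the
thermal f-sum ceiling `thermalStiffnessTT'_mul_sq_le_kinetic`.

References: ParamekantiTrivediRanderia1998 §IV eqs. (trial)–(leg-bd), (trial-rho);
HazraVermaRanderia2019 (2)–(4), App. C.
-/

noncomputable section

namespace Summit.HubbardSuperconductivity.HubbardLadder.Bounds

open Finset Real Matrix
open Literature.MathematicalPhysics.QuantumLattice Literature.MathematicalPhysics.QuantumFieldTheory
  Literature.Probability.LatticeModels
open scoped ComplexConjugate ComplexOrder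

/-! ### Theorem 4, `T > 0`: the thermal gauge-function stiffness ceiling -/

/-- **The gauge-function (resistor-network) stiffness ceiling for the `t–t'` class, `T > 0`**
(bounds.tex Thm 4, `T > 0` clause, SHARPENED: exact thermal bond weights of either sign, `ρ_s` of
either sign; PTR98 §IV eq. (trial-rho)): for `L ≥ 3`, every `t'`, `U`, `β > 0`, `θ₀ > 0`, every
coordinate sector `p`, every real `ρ_s` with `β ρ_s θ² ≤ log Z_{β,p}(0) − log Z_{β,p}(θ)` for
`|θ| ≤ θ₀`, and EVERY `φ : (ℤ/L)² → ℝ`: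
`ρ_s L² ≤ ½ [Σ_{x,i,σ} (δ_{i,0} + φ(x+eᵢ) − φ(x))² Re⟨B_{x,i,σ}⟩_{β,p}
 + t' Σ_{s,x,σ} (1 + φ(x+j_s) − φ(x))² Re⟨B^d_{s,x,σ}⟩_{β,p}]`.
PROVED (`thermalGaugeFunctionStiffnessCeilingTT'_holds`). -/
@[conjecture] def ThermalGaugeFunctionStiffnessCeilingTT' : Prop :=
  ∀ (L : ℕ) [NeZero L], 3 ≤ L → ∀ (t' U β ρs θ₀ : ℝ), 0 < β → 0 < θ₀ →
    ∀ (p : Finset (Orb (FermionTorus 2 L)) → Prop) [Fintype {a // p a}] [DecidableEq {a // p a}],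
    (∀ θ : ℝ, |θ| ≤ θ₀ → β * ρs * θ ^ 2 ≤
        Real.log (partitionFn β ((hubbardTorusTT'Flux L t' U 0).toBlock p p)).re -
          Real.log (partitionFn β ((hubbardTorusTT'Flux L t' U θ).toBlock p p)).re) →
    ∀ φ : Site 2 L → ℝ,
      ρs * (L : ℝ) ^ 2 ≤
        ((∑ x : Site 2 L, ∑ i : Fin 2, ∑ σ : Fin 2,
            ((![1, 0] : Fin 2 → ℝ) i + φ (x.shift i) - φ x) ^ 2 *
              (gibbsState β ((hubbardTorusTT' L 1 t' U).toBlock p p)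
                ((creation (orb (FermionTorus.ofTorusSite (Site.shift x i)) σ) *
                    annihilation (orb (FermionTorus.ofTorusSite x) σ) +
                  creation (orb (FermionTorus.ofTorusSite x) σ) *
                    annihilation (orb (FermionTorus.ofTorusSite (Site.shift x i)) σ)).toBlock p p)).re) +
          t' * ∑ s : Fin 2, ∑ x : Site 2 L, ∑ σ : Fin 2,
            (1 + φ (x + torusDiagJump L s) - φ x) ^ 2 *
              (gibbsState β ((hubbardTorusTT' L 1 t' U).toBlock p p)
                ((creation (orb (FermionTorus.ofTorusSite (x + torusDiagJump L s)) σ) *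
                    annihilation (orb (FermionTorus.ofTorusSite x) σ) +
                  creation (orb (FermionTorus.ofTorusSite x) σ) *
                    annihilation (orb (FermionTorus.ofTorusSite (x + torusDiagJump L s)) σ)).toBlock
                  p p)).re) / 2

/-- PROOF of `ThermalGaugeFunctionStiffnessCeilingTT'`: the Literature `1 − cos` bound
`log_partitionFn_toBlock_hubbardTorusTT'Flux_ge_trialGauge` (Peierls–Bogoliubov at `±θ` in the PTR
trial gauge) for `0 < θ ≤ θ₀`, divided by `β > 0`, then `mul_sq_le_sum_of_forall_oneSubCos` over the
disjoint union of the nearest-neighbour and the diagonal bond families. -/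
theorem thermalGaugeFunctionStiffnessCeilingTT'_holds : ThermalGaugeFunctionStiffnessCeilingTT' := by
  intro L _ hL t' U β ρs θ₀ hβ hθ₀ p _ _ hstiff φ
  have hL0 : (0 : ℝ) < L := by exact_mod_cast (show 0 < L by omega)
  let w : (Site 2 L × Fin 2 × Fin 2) ⊕ (Fin 2 × Site 2 L × Fin 2) → ℝ :=
    Sum.elim
      (fun q => (gibbsState β ((hubbardTorusTT' L 1 t' U).toBlock p p)
        ((creation (orb (FermionTorus.ofTorusSite (Site.shift q.1 q.2.1)) q.2.2) *
            annihilation (orb (FermionTorus.ofTorusSite q.1) q.2.2) +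
          creation (orb (FermionTorus.ofTorusSite q.1) q.2.2) *
            annihilation (orb (FermionTorus.ofTorusSite (Site.shift q.1 q.2.1)) q.2.2)).toBlock
          p p)).re / 2)
      (fun q => t' * (gibbsState β ((hubbardTorusTT' L 1 t' U).toBlock p p)
        ((creation (orb (FermionTorus.ofTorusSite (q.2.1 + torusDiagJump L q.1)) q.2.2) *
            annihilation (orb (FermionTorus.ofTorusSite q.2.1) q.2.2) +
          creation (orb (FermionTorus.ofTorusSite q.2.1) q.2.2) *
            annihilation (orb (FermionTorus.ofTorusSite (q.2.1 + torusDiagJump L q.1))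
              q.2.2)).toBlock p p)).re / 2)
  let d : (Site 2 L × Fin 2 × Fin 2) ⊕ (Fin 2 × Site 2 L × Fin 2) → ℝ :=
    Sum.elim (fun q => (![1, 0] : Fin 2 → ℝ) q.2.1 + φ (q.1.shift q.2.1) - φ q.1)
      (fun q => 1 + φ (q.2.1 + torusDiagJump L q.1) - φ q.2.1)
  have hrhs : ∀ θ : ℝ,
      (∑ x : Site 2 L, ∑ i : Fin 2, ∑ σ : Fin 2,
          (1 - Real.cos (θ / L * ((![1, 0] : Fin 2 → ℝ) i + φ (x.shift i) - φ x))) *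
            (gibbsState β ((hubbardTorusTT' L 1 t' U).toBlock p p)
              ((creation (orb (FermionTorus.ofTorusSite (Site.shift x i)) σ) *
                  annihilation (orb (FermionTorus.ofTorusSite x) σ) +
                creation (orb (FermionTorus.ofTorusSite x) σ) *
                  annihilation (orb (FermionTorus.ofTorusSite (Site.shift x i)) σ)).toBlock p p)).re) +
        t' * ∑ s : Fin 2, ∑ x : Site 2 L, ∑ σ : Fin 2,
          (1 - Real.cos (θ / L * (1 + φ (x + torusDiagJump L s) - φ x))) *
            (gibbsState β ((hubbardTorusTT' L 1 t' U).toBlock p p)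
              ((creation (orb (FermionTorus.ofTorusSite (x + torusDiagJump L s)) σ) *
                  annihilation (orb (FermionTorus.ofTorusSite x) σ) +
                creation (orb (FermionTorus.ofTorusSite x) σ) *
                  annihilation (orb (FermionTorus.ofTorusSite (x + torusDiagJump L s)) σ)).toBlock
                p p)).re =
        ∑ b, 2 * (1 - Real.cos (θ / L * d b)) * w b := by
    intro θ
    simp only [w, d, Fintype.sum_sum_type, Fintype.sum_prod_type, Sum.elim_inl, Sum.elim_inr,
      Finset.mul_sum]
    congr 1
    · refine Finset.sum_congr rfl fun x _ => Finset.sum_congr rfl fun i _ =>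
        Finset.sum_congr rfl fun σ _ => ?_
      ring
    · refine Finset.sum_congr rfl fun s _ => Finset.sum_congr rfl fun x _ =>
        Finset.sum_congr rfl fun σ _ => ?_
      ring
  have hconc :
      ((∑ x : Site 2 L, ∑ i : Fin 2, ∑ σ : Fin 2,
          ((![1, 0] : Fin 2 → ℝ) i + φ (x.shift i) - φ x) ^ 2 *
            (gibbsState β ((hubbardTorusTT' L 1 t' U).toBlock p p)
              ((creation (orb (FermionTorus.ofTorusSite (Site.shift x i)) σ) *
                  annihilation (orb (FermionTorus.ofTorusSite x) σ) +
                creation (orb (FermionTorus.ofTorusSite x) σ) *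
                  annihilation (orb (FermionTorus.ofTorusSite (Site.shift x i)) σ)).toBlock p p)).re) +
        t' * ∑ s : Fin 2, ∑ x : Site 2 L, ∑ σ : Fin 2,
          (1 + φ (x + torusDiagJump L s) - φ x) ^ 2 *
            (gibbsState β ((hubbardTorusTT' L 1 t' U).toBlock p p)
              ((creation (orb (FermionTorus.ofTorusSite (x + torusDiagJump L s)) σ) *
                  annihilation (orb (FermionTorus.ofTorusSite x) σ) +
                creation (orb (FermionTorus.ofTorusSite x) σ) *
                  annihilation (orb (FermionTorus.ofTorusSite (x + torusDiagJump L s)) σ)).toBlock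
                p p)).re) / 2 =
        ∑ b, d b ^ 2 * w b := by
    simp only [w, d, Fintype.sum_sum_type, Fintype.sum_prod_type, Sum.elim_inl, Sum.elim_inr,
      Finset.mul_sum, Finset.sum_div, add_div]
    congr 1
    · refine Finset.sum_congr rfl fun x _ => Finset.sum_congr rfl fun i _ =>
        Finset.sum_congr rfl fun σ _ => ?_
      ring
    · refine Finset.sum_congr rfl fun s _ => Finset.sum_congr rfl fun x _ =>
        Finset.sum_congr rfl fun σ _ => ?_
      ring
  rw [hconc]
  refine mul_sq_le_sum_of_forall_oneSubCos hL0 hθ₀ w d fun θ hθ hθ1 => ?_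
  rw [← hrhs θ]
  have h1 := hstiff θ (by rwa [abs_of_pos hθ])
  rw [hubbardTorusTT'Flux_zero] at h1
  have h2 := log_partitionFn_toBlock_hubbardTorusTT'Flux_ge_trialGauge hL t' U θ β φ p
  refine le_of_mul_le_mul_left ?_ hβ
  linarith

/-! ### Thermal column potentials: the series law and the bottleneck bound at `T > 0` -/

section Columns

variable {L : ℕ} [NeZero L]

/-- The **thermal crossing weight** of the site `x` in the sector `p`: half the Gibbs expectations of
the symmetrised bond operators of the three bonds from column `x₁` to column `x₁ + 1` starting at
`x` (`x → x + e₁` and the diagonals `x → x + j_s`, weighted by `t'`). -/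
def thermalXCrossWeightTT' (t' U β : ℝ) (p : Finset (Orb (FermionTorus 2 L)) → Prop)
    [Fintype {a // p a}] [DecidableEq {a // p a}] (x : Site 2 L) : ℝ :=
  (∑ σ : Fin 2, (gibbsState β ((hubbardTorusTT' L 1 t' U).toBlock p p)
      ((creation (orb (FermionTorus.ofTorusSite (Site.shift x 0)) σ) *
          annihilation (orb (FermionTorus.ofTorusSite x) σ) +
        creation (orb (FermionTorus.ofTorusSite x) σ) *
          annihilation (orb (FermionTorus.ofTorusSite (Site.shift x 0)) σ)).toBlock p p)).re / 2) +
    t' * ∑ s : Fin 2, ∑ σ : Fin 2, (gibbsState β ((hubbardTorusTT' L 1 t' U).toBlock p p)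
      ((creation (orb (FermionTorus.ofTorusSite (x + torusDiagJump L s)) σ) *
          annihilation (orb (FermionTorus.ofTorusSite x) σ) +
        creation (orb (FermionTorus.ofTorusSite x) σ) *
          annihilation (orb (FermionTorus.ofTorusSite (x + torusDiagJump L s)) σ)).toBlock p p)).re / 2

/-- The **thermal column weight** `W_c = Σ_y w_{(c,y)}`: the thermal kinetic weight across the cut
between the columns `x₁ = c` and `x₁ = c + 1` (the conductance of that cut in the PTR network). -/
def thermalColumnWeightTT' (t' U β : ℝ) (p : Finset (Orb (FermionTorus 2 L)) → Prop)
    [Fintype {a // p a}] [DecidableEq {a // p a}] (c : ZMod L) : ℝ :=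
  ∑ y : ZMod L, thermalXCrossWeightTT' t' U β p ![c, y]

/-- Weighted site sums of the thermal crossing weights, split into the `e₁`-bond and diagonal parts. -/
theorem sum_mul_thermalXCrossWeightTT' (t' U β : ℝ) (p : Finset (Orb (FermionTorus 2 L)) → Prop)
    [Fintype {a // p a}] [DecidableEq {a // p a}] (a : Site 2 L → ℝ) :
    ∑ x : Site 2 L, a x * thermalXCrossWeightTT' t' U β p x =
      ((∑ x : Site 2 L, ∑ σ : Fin 2, a x * (gibbsState β ((hubbardTorusTT' L 1 t' U).toBlock p p)
          ((creation (orb (FermionTorus.ofTorusSite (Site.shift x 0)) σ) *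
              annihilation (orb (FermionTorus.ofTorusSite x) σ) +
            creation (orb (FermionTorus.ofTorusSite x) σ) *
              annihilation (orb (FermionTorus.ofTorusSite (Site.shift x 0)) σ)).toBlock p p)).re) +
        t' * ∑ s : Fin 2, ∑ x : Site 2 L, ∑ σ : Fin 2, a x *
          (gibbsState β ((hubbardTorusTT' L 1 t' U).toBlock p p)
            ((creation (orb (FermionTorus.ofTorusSite (x + torusDiagJump L s)) σ) *
                annihilation (orb (FermionTorus.ofTorusSite x) σ) +
              creation (orb (FermionTorus.ofTorusSite x) σ) *
                annihilation (orb (FermionTorus.ofTorusSite (x + torusDiagJump L s)) σ)).toBlock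
              p p)).re) / 2 := by
  simp only [thermalXCrossWeightTT', mul_add, Finset.sum_add_distrib, Finset.mul_sum, Finset.sum_div,
    add_div]
  congr 1
  · refine Finset.sum_congr rfl fun x _ => Finset.sum_congr rfl fun σ _ => ?_
    ring
  · rw [Finset.sum_comm]
    refine Finset.sum_congr rfl fun s _ => Finset.sum_congr rfl fun x _ =>
      Finset.sum_congr rfl fun σ _ => ?_
    ring

/-- Column sums: a weight depending on `x₁` only sees the thermal column weights `W_c`. -/
theorem sum_columns_mul_thermalXCrossWeightTT' (t' U β : ℝ)
    (p : Finset (Orb (FermionTorus 2 L)) → Prop) [Fintype {a // p a}] [DecidableEq {a // p a}]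
    (G : ZMod L → ℝ) :
    ∑ x : Site 2 L, G (x 0) * thermalXCrossWeightTT' t' U β p x =
      ∑ c : ZMod L, G c * thermalColumnWeightTT' t' U β p c := by
  rw [sum_site_eq_sum_columns]
  refine Finset.sum_congr rfl fun c _ => ?_
  rw [thermalColumnWeightTT', Finset.mul_sum]
  refine Finset.sum_congr rfl fun y _ => ?_
  simp only [Matrix.cons_val_zero]

end Columns

/-- **Column form of the thermal gauge-function ceiling** (PROVED): for `L ≥ 3` and data as in
`ThermalGaugeFunctionStiffnessCeilingTT'`, every `g : ℤ/L → ℝ` with `Σ_c g(c) = L` gives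
`ρ_s L² ≤ Σ_c g(c)² W_c` (`W_c = thermalColumnWeightTT'`; potentials `φ(x) = f(x₁)`). -/
@[conjecture] def ThermalColumnStiffnessCeilingTT' : Prop :=
  ∀ (L : ℕ) [NeZero L], 3 ≤ L → ∀ (t' U β ρs θ₀ : ℝ), 0 < β → 0 < θ₀ →
    ∀ (p : Finset (Orb (FermionTorus 2 L)) → Prop) [Fintype {a // p a}] [DecidableEq {a // p a}],
    (∀ θ : ℝ, |θ| ≤ θ₀ → β * ρs * θ ^ 2 ≤
        Real.log (partitionFn β ((hubbardTorusTT'Flux L t' U 0).toBlock p p)).re -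
          Real.log (partitionFn β ((hubbardTorusTT'Flux L t' U θ).toBlock p p)).re) →
    ∀ g : ZMod L → ℝ, ∑ c : ZMod L, g c = L →
      ρs * (L : ℝ) ^ 2 ≤ ∑ c : ZMod L, g c ^ 2 * thermalColumnWeightTT' t' U β p c

/-- PROOF of `ThermalColumnStiffnessCeilingTT'`: `ThermalGaugeFunctionStiffnessCeilingTT'` with
`φ(x) = f(x₁)`, `f` from `exists_potential_of_sum_eq`. -/
theorem thermalColumnStiffnessCeilingTT'_holds : ThermalColumnStiffnessCeilingTT' := by
  intro L _ hL t' U β ρs θ₀ hβ hθ₀ p _ _ hstiff g hg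
  obtain ⟨f, hf⟩ := exists_potential_of_sum_eq (by omega) g hg
  have key := thermalGaugeFunctionStiffnessCeilingTT'_holds L hL t' U β ρs θ₀ hβ hθ₀ p hstiff
    (fun x => f (x 0))
  rw [← show (∑ x : Site 2 L, g (x 0) ^ 2 * thermalXCrossWeightTT' t' U β p x) =
      ∑ c : ZMod L, g c ^ 2 * thermalColumnWeightTT' t' U β p c from
    sum_columns_mul_thermalXCrossWeightTT' t' U β p (fun c => g c ^ 2)]
  refine key.trans_eq ?_
  rw [sum_mul_thermalXCrossWeightTT']
  congr 2
  · refine Finset.sum_congr rfl fun x _ => ?_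
    simp only [Fin.sum_univ_two, Matrix.cons_val_zero, Matrix.cons_val_one, Matrix.cons_val_fin_one,
      shift_zero_apply_zero, shift_one_apply_zero, hf, zero_add, sub_self, ne_eq, OfNat.ofNat_ne_zero,
      not_false_eq_true, zero_pow, zero_mul, add_zero]
  · congr 1
    refine Finset.sum_congr rfl fun s _ => Finset.sum_congr rfl fun x _ =>
      Finset.sum_congr rfl fun σ _ => ?_
    rw [add_torusDiagJump_apply_zero, hf]

/-- **The thermal series law (harmonic-mean) stiffness ceiling** (PROVED; PTR98 §IV eqs. (1d-bd),
(leg-bd) `D_s ≤ D°_s` at `T > 0`, resistors in series along `e₁`): for `L ≥ 3` and data as in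
`ThermalGaugeFunctionStiffnessCeilingTT'`, if every thermal column weight `W_c`
(`thermalColumnWeightTT'`) is positive, then `ρ_s ≤ (Σ_c W_c⁻¹)⁻¹` — at most the harmonic mean of
the column weights divided by `L`, hence at most their arithmetic mean (the thermal f-sum ceiling). -/
@[conjecture] def ThermalSeriesLawStiffnessCeilingTT' : Prop :=
  ∀ (L : ℕ) [NeZero L], 3 ≤ L → ∀ (t' U β ρs θ₀ : ℝ), 0 < β → 0 < θ₀ →
    ∀ (p : Finset (Orb (FermionTorus 2 L)) → Prop) [Fintype {a // p a}] [DecidableEq {a // p a}],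
    (∀ θ : ℝ, |θ| ≤ θ₀ → β * ρs * θ ^ 2 ≤
        Real.log (partitionFn β ((hubbardTorusTT'Flux L t' U 0).toBlock p p)).re -
          Real.log (partitionFn β ((hubbardTorusTT'Flux L t' U θ).toBlock p p)).re) →
    (∀ c : ZMod L, 0 < thermalColumnWeightTT' t' U β p c) →
      ρs ≤ (∑ c : ZMod L, (thermalColumnWeightTT' t' U β p c)⁻¹)⁻¹

/-- PROOF of `ThermalSeriesLawStiffnessCeilingTT'`: `ThermalColumnStiffnessCeilingTT'` with the
Kirchhoff drops `g(c) = λ / W_c`, `λ = L / Σ_c W_c⁻¹`. -/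
theorem thermalSeriesLawStiffnessCeilingTT'_holds : ThermalSeriesLawStiffnessCeilingTT' := by
  intro L _ hL t' U β ρs θ₀ hβ hθ₀ p _ _ hstiff hW
  set W : ZMod L → ℝ := thermalColumnWeightTT' t' U β p with hWdef
  set S : ℝ := ∑ c : ZMod L, (W c)⁻¹ with hS
  have hL0 : (0 : ℝ) < L := by exact_mod_cast (show 0 < L by omega)
  have hS0 : 0 < S := Finset.sum_pos (fun c _ => inv_pos.2 (hW c)) ⟨0, Finset.mem_univ _⟩
  set lam : ℝ := L / S with hlam
  have hg : ∑ c : ZMod L, lam / W c = L := by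
    simp only [div_eq_mul_inv, ← Finset.mul_sum]
    rw [← hS, hlam, div_mul_cancel₀ _ hS0.ne']
  have key := thermalColumnStiffnessCeilingTT'_holds L hL t' U β ρs θ₀ hβ hθ₀ p hstiff
    (fun c => lam / W c) hg
  have hval : ∑ c : ZMod L, (lam / W c) ^ 2 * thermalColumnWeightTT' t' U β p c = lam * L := by
    calc ∑ c : ZMod L, (lam / W c) ^ 2 * thermalColumnWeightTT' t' U β p c
        = ∑ c : ZMod L, lam * (lam / W c) := by
          refine Finset.sum_congr rfl fun c _ => ?_
          rw [← hWdef]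
          have hc : W c ≠ 0 := (hW c).ne'
          field_simp
      _ = lam * L := by rw [← Finset.mul_sum, hg]
  rw [hval, hlam] at key
  have h2 : ρs * (L : ℝ) ^ 2 ≤ S⁻¹ * (L : ℝ) ^ 2 := by
    calc ρs * (L : ℝ) ^ 2 ≤ L / S * L := key
      _ = S⁻¹ * (L : ℝ) ^ 2 := by rw [div_eq_mul_inv]; ring
  exact le_of_mul_le_mul_right h2 (by positivity)

/-- **The thermal bottleneck stiffness ceiling** (PROVED): for `L ≥ 3` and data as in
`ThermalGaugeFunctionStiffnessCeilingTT'`, EVERY column bounds the stiffness, `ρ_s ≤ W_c`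
(`thermalColumnWeightTT'`), with no sign hypothesis on `ρ_s` or on the weights (put the whole
potential drop `L` across the cut `c`). One column of vanishing thermal kinetic weight forces
`ρ_s ≤ 0`. -/
@[conjecture] def ThermalBottleneckStiffnessCeilingTT' : Prop :=
  ∀ (L : ℕ) [NeZero L], 3 ≤ L → ∀ (t' U β ρs θ₀ : ℝ), 0 < β → 0 < θ₀ →
    ∀ (p : Finset (Orb (FermionTorus 2 L)) → Prop) [Fintype {a // p a}] [DecidableEq {a // p a}],
    (∀ θ : ℝ, |θ| ≤ θ₀ → β * ρs * θ ^ 2 ≤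
        Real.log (partitionFn β ((hubbardTorusTT'Flux L t' U 0).toBlock p p)).re -
          Real.log (partitionFn β ((hubbardTorusTT'Flux L t' U θ).toBlock p p)).re) →
    ∀ c : ZMod L, ρs ≤ thermalColumnWeightTT' t' U β p c

/-- PROOF of `ThermalBottleneckStiffnessCeilingTT'`: `ThermalColumnStiffnessCeilingTT'` with
`g = L · [· = c]`. -/
theorem thermalBottleneckStiffnessCeilingTT'_holds : ThermalBottleneckStiffnessCeilingTT' := by
  intro L _ hL t' U β ρs θ₀ hβ hθ₀ p _ _ hstiff c
  have hL0 : (0 : ℝ) < L := by exact_mod_cast (show 0 < L by omega)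
  have hg : ∑ c' : ZMod L, (if c' = c then (L : ℝ) else 0) = L := by
    rw [Finset.sum_ite_eq', if_pos (Finset.mem_univ _)]
  have key := thermalColumnStiffnessCeilingTT'_holds L hL t' U β ρs θ₀ hβ hθ₀ p hstiff
    (fun c' => if c' = c then (L : ℝ) else 0) hg
  have hval : ∑ a : ZMod L, (if a = c then (L : ℝ) else 0) ^ 2 * thermalColumnWeightTT' t' U β p a =
      (L : ℝ) ^ 2 * thermalColumnWeightTT' t' U β p c := by
    simp only [ite_pow, ne_eq, OfNat.ofNat_ne_zero, not_false_eq_true, zero_pow, ite_mul, zero_mul,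
      Finset.sum_ite_eq', Finset.mem_univ, if_true]
  exact le_of_mul_le_mul_right ((key.trans_eq hval).trans_eq (mul_comm _ _)) (by positivity)

end Summit.HubbardSuperconductivity.HubbardLadder.Bounds
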